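import Summits.HodgeConjecture.HodgeConjecture.Cruxes.BlochSeedDiscOne.FineDoorRing2
import Summits.HodgeConjecture.HodgeConjecture.Cruxes.BlochSeedDiscOne.BoxCap
import Summits.HodgeConjecture.HodgeConjecture.Cruxes.BlochSeedDiscOne.ShellThreeFloorB

/-!
# FineAxisLift — the AXIS-LIFT LAW of the fine door at EVERY shell and EVERY height, and its binder corollary
# «every supported N cell hubbed ⇒ every hub-free supported P cell is ALL-AXIS» (hsemireg-sheaf8-1 g7, R-B custody instrument)

Token: line stmt-HodgeConjecture-18881 Cruxes/BlochSeedDiscOne/Lines/birth.lean 814a6a70c14e831a stub_rung_pad4_seedAt.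
LETTER-MODEL BOOKKEEPING ONLY (`DepthBoundA4.Design`).  Letters ≠ displays ≠ sheaves ≠ SEED; nothing here is proved toward
HC ∕ HC_CM ∕ HC_AV ∕ №4 ∕ 26512 ∕ 18881 ∕ H2; `Nonex 14 199 8` stays REFUTED as typed.  No `axiom` ∕ `sorry` ∕ `instance` ∕ `notation` ∕
`decide` ∕ `native_decide`: every proof below is a pen proof with the height `h` FREE (no ring ∕ shell hypothesis anywhere).

## What is proved (kernel)
The fine door is `FineDoorRing2.RuleDPFine` (support shadow of the D-MASS-P rows of record, `C4StabilitySpec` § DMass; director R19.405 ∕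
R19.681, statement of record v4.3 «SPlus-fine»).  §4b∕§6b of `FineDoorRing2` proved the single-line lifts `lift_law ∕ liftU ∕ liftA` from a
UNIT or a MID-AXIS slot, the latter two under `RingLe 3` (validity by `decide` on the 25-letter shell-3 alphabet).  Here:
* §1 alphabet lemmas, every height: a null step up from an AXIS letter runs along the axis toward the hub (`axis_up_annihilated`: the
  covector `annAx X = (−β_X, −col X)` annihilates it); the hub is one null step above `X` only if `X` is axis (`axis_of_nullStep_col_zero`);
  a non-hub letter has `β ≠ 0`.
* §2 validity, every height: the functional (`annAx` on an axis non-hub slot, `e_A*` on any non-hub slot) detects `M₁` in both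
  orientations (`fdetects_annAx_eA`: value `−β_X·conj β_ℓ`; `fdetects_eA_annAx`: value `−col X · col ℓ`, real).
* §3 **AXIS-LIFT LAW** `liftAx`: behind the fine door (`OnAlphabet h ∧ Disj ∧ RuleDPFine`, nothing else) a supported P cell with an AXIS
  non-hub letter on slot `g` and a non-hub letter on slot `j ≠ g` has a supported N cell agreeing with it off `j` and one null step above
  it on `j`.  (`FineDoorRing2.liftU ∕ liftA` are the co-level-1 ∕ -2 instances at shell 3.)
* §4 **BINDER COROLLARY** `hubfreePAxis_of_nHubbed : OnAlphabet h → Disj → RuleDPFine → BoxCap.NHubbed h → BoxCap.HubfreePAxis h`: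
  if every supported N cell carries the hub (negation's (M2) ∕ the shell-generic (M1)ₛ «hub-free N = ∅», `ShellThreeClosed.NoHubfreeN`),
  then every hub-free supported P cell is an axis cell — at EVERY shell: a hub-free P cell with an axis slot and an off-axis slot lifts
  the off-axis slot to a NON-hub letter (§1), i.e. to a hub-free N cell; one with two off-axis slots has a hub-free counted server by the
  generic row `(e₁, e₁)` (value `−β_g ≠ 0`).  So the P-side binder of the shell ledgers ((Bu) ∕ `HubfreePAxis` ∕ «(M2ₛ): hub-free P
  axis-only», the door half of SHELL-CORE §7 (F-Poff): Buuu, BBuu, uBBB, uuBG, Duuu, Fuuu, Guuu, u³X, u²BX, …) is IMPLIED by the N-side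
  binder behind the fine door; also stated with the binder in co-level words (`hubfreeP_axis_of_noHubfreeN`).
* §7 (v1.1) `noOffHubfreeP_of_nHubbed : OnAlphabet h → Disj → RuleDPFine → NHubbed h → ShellThreeFloorB.NoOffHubfreeP` — the binder (Bu) of
  the shell-3 plate `ShellThreeClosed.shell3_empty_of_binders (B) (Bu) (M2)` in ITS OWN NAME, from (M2), every shell ∕ height (asked by anomaly g18 for
  `ShellGenericPlateFA`); the three-line composition «shell-3 plate with TWO binders (B)(M2) behind the fine door» lands as a separate leaf
  `FineAxisLiftShell3.lean` once `ShellThreeClosed` is built on the farm (import probe rc 75 at 09:20Z–09:40Z).  v1.1 adds the import `ShellThreeFloorB`.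
* §8 (v1.2) **AXIS-N BINDER** «every hub-free supported N cell is an AXIS cell» (= K4PRUNE j343452's ×1 shell-4 DOOR FACT «every off-axis hub-free
  N shape is door-dead», no binder): then every hub-free supported P cell has AT MOST ONE off-axis letter (`offAxis_unique_of_hubfreeN_axis`), and that
  letter lifts one null step to an AXIS letter inside a supported hub-free N cell (`offAxis_lifts_to_axisN`) — the shape of K4PRUNE's off-axis hub-free P
  residual {Buuu, Duuu, ABuu, AABu, BCuu} next to its N residual {u⁴, Auuu, AAuu, AAAu, AAAA, Cuuu}.
* §5 **WEAK BINDER** «every hub-free supported N cell is u⁴» (the conclusion shape of dual's `FamilyLemmaN.hubfreeN_col_one_of_strict`):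
  then a hub-free supported P cell is an axis cell OR a HOOK `(X; u, u, u)` with `X` off-axis fed by TWO supported N u⁴ cells
  `x[j ↦ u′]`, `x[j ↦ u″]` through two DISTINCT units `u′ ≠ u″` one null step above `X` (`hubfreeP_axis_or_twofed_hook`; the second unit
  comes from the row (`annU`, annihilator of the line `X → u′`), valid because `X` is off-axis: `fdetects_annU_annLine`).  Machine note
  (memo, not used here): on the height-`h` alphabet an off-axis letter has two distinct units one null step above it iff
  `|x| = |y| ∈ {1, 3}` (h = 3 … 20 exhaustive), so the residual hub-free P list under the weak binder is all-axis ∪ u³B ∪ u³X₍₃,₃₎.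
-/

set_option linter.dupNamespace false
set_option autoImplicit false

namespace Summit.HodgeConjecture.HodgeConjecture.Cruxes.BlochSeedDiscOne.FineAxisLift

open Summit.HodgeConjecture.HodgeConjecture.Cruxes.BlochSeedDiscOne.DepthBoundA4
open Summit.HodgeConjecture.HodgeConjecture.Cruxes.BlochSeedDiscOne.LeggedFloor (NullStep Disj mem_supp_of_memP mem_supp_of_memN)
open Summit.HodgeConjecture.HodgeConjecture.Cruxes.BlochSeedDiscOne.FineDoorRing2
  (intG blockM₁ blockM₂ lineVec gPairing Annihilates FDetects DMassValid IsLeg IsR2a DMassCounts RuleDPFine eA annU)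
open Summit.HodgeConjecture.HodgeConjecture.Cruxes.BlochSeedDiscOne.BoxCap (NHubbed AxisCell HubfreePAxis)
open Summit.HodgeConjecture.HodgeConjecture.Cruxes.BlochSeedDiscOne.ShellThreeFloorB (NoOffHubfreeP OffAxis)

/-! ## §1 Alphabet lemmas (every height `h`) -/

/-- the annihilator of the axis line through an axis letter `X`: `(−β_X, −col X)` (for a unit this is `annU`, for a mid-axis letter `annA`). -/
def annAx (X : Letter) : Fin 2 → GaussianInt := ![-X.beta, intG (-X.colevel)]

theorem col_nonneg (ℓ : Letter) : 0 ≤ ℓ.colevel := by unfold Letter.colevel; positivity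

/-- on the alphabet `a = h − col`. -/
theorem level_eq {h : ℤ} {ℓ : Letter} (hℓ : ℓ.OnAlphabet h) : ℓ.a = h - ℓ.colevel := by
  have h1 := hℓ.1; unfold Letter.height at h1; unfold Letter.colevel; omega

/-- a letter of co-level `0` on the alphabet is the hub. -/
theorem eq_hub_of_col_zero {h : ℤ} {ℓ : Letter} (hℓ : ℓ.OnAlphabet h) (h0 : ℓ.colevel = 0) : ℓ = Letter.hub h := by
  have h1 := hℓ.1
  unfold Letter.height at h1
  unfold Letter.colevel at h0
  have hx : ℓ.x = 0 := abs_eq_zero.mp (by have := abs_nonneg ℓ.y; have := abs_nonneg ℓ.x; omega)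
  have hy : ℓ.y = 0 := abs_eq_zero.mp (by have := abs_nonneg ℓ.y; have := abs_nonneg ℓ.x; omega)
  have ha : ℓ.a = h := by rw [hx, hy] at h1; simpa using h1
  cases ℓ
  simp only [Letter.hub, Letter.mk.injEq]
  exact ⟨ha, hx, hy⟩

theorem col_zero_of_eq_hub {h : ℤ} {ℓ : Letter} (he : ℓ = Letter.hub h) : ℓ.colevel = 0 := by
  subst he; unfold Letter.colevel Letter.hub; simp

/-- a non-hub letter (co-level `≠ 0`) has `β ≠ 0`. -/
theorem beta_ne_zero_of_col_ne_zero {ℓ : Letter} (hc : ℓ.colevel ≠ 0) : ℓ.beta ≠ 0 := by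
  intro hb
  unfold Letter.beta at hb
  have hx : ℓ.x = 0 := by have := congrArg Zsqrtd.re hb; simpa using this
  have hy : ℓ.y = 0 := by have := congrArg Zsqrtd.im hb; simpa using this
  apply hc
  unfold Letter.colevel
  rw [hx, hy]; simp

/-- `star β` vanishes only when `β` does. -/
theorem star_beta_ne_zero {ℓ : Letter} (hc : ℓ.colevel ≠ 0) : star ℓ.beta ≠ 0 := by
  intro hb
  apply beta_ne_zero_of_col_ne_zero hc
  have := congrArg star hb
  simpa using this

/-- an OFF-AXIS letter (`x ≠ 0 ∧ y ≠ 0`) has co-level `≥ 2`, in particular `≠ 0` and `≠ 1`. -/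
theorem two_le_col_of_offAxis {ℓ : Letter} (hx : ℓ.x ≠ 0) (hy : ℓ.y ≠ 0) : 2 ≤ ℓ.colevel := by
  unfold Letter.colevel
  have h1 : 1 ≤ |ℓ.x| := abs_pos.mpr hx
  have h2 : 1 ≤ |ℓ.y| := abs_pos.mpr hy
  omega

/-- **every null step up from an AXIS letter of the alphabet runs along the axis toward the hub**: `annAx X` annihilates it. -/
theorem axis_up_annihilated {h : ℤ} {X ℓ : Letter} (hX : X.OnAlphabet h) (hℓ : ℓ.OnAlphabet h) (hax : X.x * X.y = 0)
    (hn : NullStep X ℓ) : Annihilates (annAx X) X ℓ := by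
  have hX1 := hX.1; have hℓ1 := hℓ.1
  unfold Letter.height at hX1 hℓ1
  obtain ⟨hlt, hsq⟩ := hn
  -- the two integer identities: `col X · (ℓ.x − X.x) = −X.x · Δa`, `col X · (ℓ.y − X.y) = −X.y · Δa`
  have key : (|X.x| + |X.y|) * (ℓ.x - X.x) = -X.x * (ℓ.a - X.a) ∧ (|X.x| + |X.y|) * (ℓ.y - X.y) = -X.y * (ℓ.a - X.a) := by
    rcases mul_eq_zero.mp hax with hx0 | hy0
    · -- X on the y-axis
      rw [hx0] at hsq hX1 ⊢
      simp only [abs_zero, zero_add, sub_zero, neg_zero, zero_mul] at hsq ⊢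
      simp only [abs_zero, add_zero] at hX1
      have hay : |ℓ.y - X.y| ≥ |X.y| - |ℓ.y| := by
        have := abs_sub_abs_le_abs_sub X.y ℓ.y; rw [abs_sub_comm] at this; linarith
      have hb : |X.y| - |ℓ.y| ≥ (ℓ.a - X.a) + |ℓ.x| := by linarith
      have hd : |ℓ.y - X.y| ≥ (ℓ.a - X.a) + |ℓ.x| := le_trans hb hay
      have hsqabs : |ℓ.y - X.y| ^ 2 + |ℓ.x| ^ 2 = (ℓ.a - X.a) ^ 2 := by rw [sq_abs, sq_abs]; linarith
      have hx0' : |ℓ.x| = 0 := by nlinarith [abs_nonneg (ℓ.y - X.y), abs_nonneg ℓ.x]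
      have hxz : ℓ.x = 0 := abs_eq_zero.mp hx0'
      refine ⟨by rw [hxz]; simp, ?_⟩
      have habs : |ℓ.y - X.y| = ℓ.a - X.a := by nlinarith [abs_nonneg (ℓ.y - X.y)]
      rcases lt_trichotomy X.y 0 with hneg | hz | hpos
      · have hXy : |X.y| = -X.y := abs_of_neg hneg
        have hly : |ℓ.y| ≤ -X.y - (ℓ.a - X.a) := by rw [hx0'] at hb; linarith
        have : ℓ.y - X.y > 0 := by have := neg_abs_le ℓ.y; linarith
        rw [abs_of_pos this] at habs
        rw [hXy]; nlinarith
      · exfalso; rw [hz] at hX1; simp at hX1; have := hℓ.2; have := abs_nonneg ℓ.x; have := abs_nonneg ℓ.y; omega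
      · have hXy : |X.y| = X.y := abs_of_pos hpos
        have hly : |ℓ.y| ≤ X.y - (ℓ.a - X.a) := by rw [hx0'] at hb; linarith
        have : ℓ.y - X.y < 0 := by have := le_abs_self ℓ.y; linarith
        rw [abs_of_neg this] at habs
        rw [hXy]; nlinarith
    · -- X on the x-axis
      rw [hy0] at hsq hX1 ⊢
      simp only [abs_zero, add_zero, sub_zero, neg_zero, zero_mul] at hsq ⊢
      simp only [abs_zero, add_zero] at hX1
      have hay : |ℓ.x - X.x| ≥ |X.x| - |ℓ.x| := by
        have := abs_sub_abs_le_abs_sub X.x ℓ.x; rw [abs_sub_comm] at this; linarith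
      have hb : |X.x| - |ℓ.x| ≥ (ℓ.a - X.a) + |ℓ.y| := by linarith
      have hd : |ℓ.x - X.x| ≥ (ℓ.a - X.a) + |ℓ.y| := le_trans hb hay
      have hsqabs : |ℓ.x - X.x| ^ 2 + |ℓ.y| ^ 2 = (ℓ.a - X.a) ^ 2 := by rw [sq_abs, sq_abs]; linarith
      have hy0' : |ℓ.y| = 0 := by nlinarith [abs_nonneg (ℓ.x - X.x), abs_nonneg ℓ.y]
      have hyz : ℓ.y = 0 := abs_eq_zero.mp hy0'
      refine ⟨?_, by rw [hyz]; simp⟩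
      have habs : |ℓ.x - X.x| = ℓ.a - X.a := by nlinarith [abs_nonneg (ℓ.x - X.x)]
      rcases lt_trichotomy X.x 0 with hneg | hz | hpos
      · have hXx : |X.x| = -X.x := abs_of_neg hneg
        have hlx : |ℓ.x| ≤ -X.x - (ℓ.a - X.a) := by rw [hy0'] at hb; linarith
        have : ℓ.x - X.x > 0 := by have := neg_abs_le ℓ.x; linarith
        rw [abs_of_pos this] at habs
        rw [hXx]; nlinarith
      · exfalso; rw [hz] at hX1; simp at hX1; have := hℓ.2; have := abs_nonneg ℓ.x; have := abs_nonneg ℓ.y; omega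
      · have hXx : |X.x| = X.x := abs_of_pos hpos
        have hlx : |ℓ.x| ≤ X.x - (ℓ.a - X.a) := by rw [hy0'] at hb; linarith
        have : ℓ.x - X.x < 0 := by have := le_abs_self ℓ.x; linarith
        rw [abs_of_neg this] at habs
        rw [hXx]; nlinarith
  obtain ⟨kx, ky⟩ := key
  unfold Annihilates gPairing lineVec annAx intG Letter.beta Letter.colevel
  refine Zsqrtd.ext_iff.mpr ⟨?_, ?_⟩
  · simp [Zsqrtd.re_mul, Zsqrtd.re_add, Zsqrtd.re_neg, Zsqrtd.re_sub]; linarith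
  · simp [Zsqrtd.im_mul, Zsqrtd.im_add, Zsqrtd.im_neg, Zsqrtd.im_sub]; linarith

/-- **the hub is one null step above `X` only if `X` is axis**: a null step into a co-level-0 letter starts from an axis letter. -/
theorem axis_of_nullStep_col_zero {h : ℤ} {X ℓ : Letter} (hX : X.OnAlphabet h) (hℓ : ℓ.OnAlphabet h) (hn : NullStep X ℓ)
    (h0 : ℓ.colevel = 0) : X.x * X.y = 0 := by
  have he := eq_hub_of_col_zero hℓ h0
  subst he
  have hX1 := hX.1
  unfold Letter.height at hX1
  obtain ⟨hlt, hsq⟩ := hn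
  simp only [Letter.hub, zero_sub] at hsq hlt
  have hsq' : X.x ^ 2 + X.y ^ 2 = (|X.x| + |X.y|) ^ 2 := by
    have : (h - X.a) = |X.x| + |X.y| := by linarith
    rw [← this]; linarith [hsq]
  have hxy : |X.x| * |X.y| = 0 := by nlinarith [sq_abs X.x, sq_abs X.y]
  rw [← abs_mul] at hxy
  exact abs_eq_zero.mp hxy

/-- contrapositive: one null step above an OFF-AXIS letter is never the hub (co-level `≠ 0`). -/
theorem col_ne_zero_above_offAxis {h : ℤ} {X ℓ : Letter} (hX : X.OnAlphabet h) (hℓ : ℓ.OnAlphabet h) (hn : NullStep X ℓ)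
    (hx : X.x ≠ 0) (hy : X.y ≠ 0) : ℓ.colevel ≠ 0 :=
  fun h0 => (mul_ne_zero hx hy) (axis_of_nullStep_col_zero hX hℓ hn h0)

/-- a null step up from a UNIT of the alphabet lands on the hub, and `annU` annihilates it (every height; `FineDoorRing2.annU_annihilates`
is the `h = 14` instance by `decide`). -/
theorem annU_annihilates_gen {h : ℤ} {u ℓ : Letter} (hu : u.OnAlphabet h) (hℓ : ℓ.OnAlphabet h) (h1 : u.colevel = 1)
    (hn : NullStep u ℓ) : Annihilates (annU u) u ℓ := by
  have hax : u.x * u.y = 0 := by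
    unfold Letter.colevel at h1
    rcases (abs_nonneg u.x).lt_or_eq with hlt | heq
    · have : |u.y| = 0 := by have := abs_nonneg u.y; omega
      rw [abs_eq_zero.mp this]; ring
    · rw [abs_eq_zero.mp heq.symm]; ring
  have := axis_up_annihilated hu hℓ hax hn
  unfold annAx at this
  rw [h1] at this
  exact this

/-! ## §2 Validity of the axis functional (every height) -/

/-- (axis slot first) `annAx(X)ᵀ · [[conj β_ℓ, a_ℓ − a_X],[0, −β_X]] · e_A* = −β_X · conj β_ℓ ≠ 0` for non-hub `X`, `ℓ`. -/
theorem fdetects_annAx_eA (c : Cell) (g j : Fin 4) (hg : (c g).colevel ≠ 0) (hj : (c j).colevel ≠ 0) :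
    FDetects (annAx (c g)) eA (blockM₁ c g j) := by
  unfold FDetects blockM₁ annAx eA
  simp only [Matrix.of_apply, Matrix.cons_val', Matrix.cons_val_zero, Matrix.cons_val_one,
    Matrix.empty_val', Matrix.cons_val_fin_one, mul_one, mul_zero, add_zero]
  exact mul_ne_zero (neg_ne_zero.mpr (beta_ne_zero_of_col_ne_zero hg)) (star_beta_ne_zero hj)

/-- (axis slot second) `e_A*ᵀ · [[conj β_X, a_X − a_ℓ],[0, −β_ℓ]] · annAx(X) = −|β_X|² − col X·(a_X − a_ℓ) = −col X · col ℓ ≠ 0` on the alphabet,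
for an AXIS non-hub `X` and a non-hub `ℓ`. -/
theorem fdetects_eA_annAx {h : ℤ} (c : Cell) (g j : Fin 4) (hgA : (c g).OnAlphabet h) (hjA : (c j).OnAlphabet h)
    (hax : (c j).x * (c j).y = 0) (hg : (c g).colevel ≠ 0) (hj : (c j).colevel ≠ 0) :
    FDetects eA (annAx (c j)) (blockM₁ c g j) := by
  have hga := level_eq hgA; have hja := level_eq hjA
  have hsq : (c j).x * (c j).x + (c j).y * (c j).y = (c j).colevel * (c j).colevel := by
    unfold Letter.colevel
    rcases mul_eq_zero.mp hax with h0 | h0 <;> · rw [h0]; simp [← sq, sq_abs]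
  have hpos : 0 < (c g).colevel * (c j).colevel :=
    mul_pos (lt_of_le_of_ne (col_nonneg _) (Ne.symm hg)) (lt_of_le_of_ne (col_nonneg _) (Ne.symm hj))
  unfold FDetects blockM₁ annAx eA intG
  simp only [Matrix.of_apply, Matrix.cons_val', Matrix.cons_val_zero, Matrix.cons_val_one,
    Matrix.empty_val', Matrix.cons_val_fin_one, one_mul, zero_mul, add_zero]
  have hd : (c j).a - (c g).a = (c g).colevel - (c j).colevel := by rw [hga, hja]; ring
  intro h0
  have := congrArg Zsqrtd.re h0
  simp [Zsqrtd.re_mul, Zsqrtd.re_add, Zsqrtd.star_mk, Letter.beta] at this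
  rw [hd] at this
  nlinarith [hsq, hpos, this]

/-- the generic row `(e₁, e₁)`, `e₁ = (0, 1)`: value `−β_g`, valid at any block whose first letter is non-hub. -/
def e₁ : Fin 2 → GaussianInt := ![0, 1]

theorem fdetects_e₁_e₁ (c : Cell) (g j : Fin 4) (hg : (c g).colevel ≠ 0) : FDetects e₁ e₁ (blockM₁ c g j) := by
  unfold FDetects blockM₁ e₁
  simp only [Matrix.of_apply, Matrix.cons_val', Matrix.cons_val_zero, Matrix.cons_val_one,
    Matrix.empty_val', Matrix.cons_val_fin_one, one_mul, zero_mul, add_zero, zero_add, mul_one, mul_zero]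
  exact neg_ne_zero.mpr (beta_ne_zero_of_col_ne_zero hg)

/-! ## §3 THE AXIS-LIFT LAW (every shell, every height) -/

section
variable {h : ℤ} {D : Design}

/-- **AXIS-LIFT LAW.** Behind the fine door (`OnAlphabet h ∧ Disj ∧ RuleDPFine` — no ring, no (A1), no LAW F, no budget), a supported
P cell `x` with an AXIS non-hub letter on slot `g` and a non-hub letter on slot `j ≠ g` has a supported N cell `y` that agrees with `x`
off `j` and sits one null step above `x j` on `j`.  (Row: `annAx (x g)` on `g`, `e_A*` on `j`; the identical server is excluded by `Disj`,
every `g`-leg and every (r2a) partner moves along the axis line of `x g` and is annihilated, so the counted server is a `j`-leg.) -/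
theorem liftAx (hD : D.OnAlphabet h) (hdisj : Disj D) (hfine : RuleDPFine D) {x : Cell} (hx : x ∈ D.suppP)
    {g j : Fin 4} (hgj : g ≠ j) (hax : (x g).x * (x g).y = 0) (hg : (x g).colevel ≠ 0) (hj : (x j).colevel ≠ 0) :
    ∃ y ∈ D.suppN, (∀ t : Fin 4, t ≠ j → x t = y t) ∧ NullStep (x j) (y j) := by
  have hxA : ∀ s : Fin 4, (x s).OnAlphabet h := fun s => hD x (mem_supp_of_memP D hx) s
  rcases lt_or_gt_of_ne hgj with hlt | hlt
  · have hval : DMassValid x g j (annAx (x g)) eA := ⟨hlt, Or.inl (fdetects_annAx_eA x g j hg hj)⟩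
    obtain ⟨y, hy, hc⟩ := hfine x hx g j _ _ hval
    have hyA : ∀ s : Fin 4, (y s).OnAlphabet h := fun s => hD y (mem_supp_of_memN D hy) s
    rcases hc with heq | ⟨hleg, hna⟩ | ⟨hleg, -⟩ | ⟨hr, hna, -⟩
    · exact (hdisj y hy (heq ▸ hx)).elim
    · exact (hna (axis_up_annihilated (hxA g) (hyA g) hax hleg.1)).elim
    · exact ⟨y, hy, hleg.2, hleg.1⟩
    · exact (hna (axis_up_annihilated (hxA g) (hyA g) hax hr.2.1)).elim
  · have hval : DMassValid x j g eA (annAx (x g)) := ⟨hlt, Or.inl (fdetects_eA_annAx x j g (hxA j) (hxA g) hax hj hg)⟩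
    obtain ⟨y, hy, hc⟩ := hfine x hx j g _ _ hval
    have hyA : ∀ s : Fin 4, (y s).OnAlphabet h := fun s => hD y (mem_supp_of_memN D hy) s
    rcases hc with heq | ⟨hleg, -⟩ | ⟨hleg, hna⟩ | ⟨hr, -, hnb⟩
    · exact (hdisj y hy (heq ▸ hx)).elim
    · exact ⟨y, hy, hleg.2, hleg.1⟩
    · exact (hna (axis_up_annihilated (hxA g) (hyA g) hax hleg.1)).elim
    · exact (hnb (axis_up_annihilated (hxA g) (hyA g) hax hr.2.2.1)).elim

/-- **GENERIC LIFT at a block of two non-hub letters** (row `(e₁, e₁)`): some supported N cell agrees with `x` off `{g, j}` and is reached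
by a leg on `g`, a leg on `j`, or an (r2a) partner — in every case it differs from `x` only by null steps UP on `g` and∕or `j`. -/
theorem liftGeneric (hdisj : Disj D) (hfine : RuleDPFine D) {x : Cell} (hx : x ∈ D.suppP)
    {g j : Fin 4} (hgj : g < j) (hg : (x g).colevel ≠ 0) :
    ∃ y ∈ D.suppN, (∀ t : Fin 4, t ≠ g → t ≠ j → x t = y t) ∧
      (x g = y g ∨ NullStep (x g) (y g)) ∧ (x j = y j ∨ NullStep (x j) (y j)) ∧ x ≠ y := by
  have hval : DMassValid x g j e₁ e₁ := ⟨hgj, Or.inl (fdetects_e₁_e₁ x g j hg)⟩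
  obtain ⟨y, hy, hc⟩ := hfine x hx g j _ _ hval
  have hne : x ≠ y := fun heq => hdisj y hy (heq ▸ hx)
  rcases hc with heq | ⟨hleg, -⟩ | ⟨hleg, -⟩ | ⟨hr, -, -⟩
  · exact (hne heq).elim
  · refine ⟨y, hy, fun t ht _ => hleg.2 t ht, Or.inr hleg.1, Or.inl (hleg.2 j (ne_of_gt hgj)), hne⟩
  · refine ⟨y, hy, fun t _ ht => hleg.2 t ht, Or.inl (hleg.2 g (ne_of_lt hgj)), Or.inr hleg.1, hne⟩
  · exact ⟨y, hy, fun t ht ht' => hr.2.2.2 t ht ht', Or.inr hr.2.1, Or.inr hr.2.2.1, hne⟩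

/-! ## §4 THE BINDER COROLLARY: N hubbed ⇒ hub-free P all-axis (every shell, every height) -/

/-- **a hub-free supported P cell with an OFF-AXIS slot has a HUB-FREE supported N partner** behind the fine door (every shell). -/
theorem hubfreeN_partner_of_offAxis (hD : D.OnAlphabet h) (hdisj : Disj D) (hfine : RuleDPFine D) {x : Cell} (hx : x ∈ D.suppP)
    (hfree : ∀ f : Fin 4, (x f).colevel ≠ 0) {j : Fin 4} (hjx : (x j).x ≠ 0) (hjy : (x j).y ≠ 0) :
    ∃ y ∈ D.suppN, ∀ f : Fin 4, (y f).colevel ≠ 0 := by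
  have hxA : ∀ s : Fin 4, (x s).OnAlphabet h := fun s => hD x (mem_supp_of_memP D hx) s
  by_cases hax : ∃ g : Fin 4, g ≠ j ∧ (x g).x * (x g).y = 0
  · obtain ⟨g, hgj, hgax⟩ := hax
    obtain ⟨y, hy, heq, hn⟩ := liftAx hD hdisj hfine hx hgj hgax (hfree g) (hfree j)
    have hyA : ∀ s : Fin 4, (y s).OnAlphabet h := fun s => hD y (mem_supp_of_memN D hy) s
    refine ⟨y, hy, fun f => ?_⟩
    by_cases hf : f = j
    · subst hf; exact col_ne_zero_above_offAxis (hxA f) (hyA f) hn hjx hjy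
    · rw [← heq f hf]; exact hfree f
  · push Not at hax
    -- every slot other than `j` is off-axis too: use the generic row at a block `{g, j}`
    obtain ⟨g, hgj⟩ : ∃ g : Fin 4, g ≠ j := ⟨j + 1, by
      intro hq
      have := congrArg (fun t : Fin 4 => t - j) hq
      simp at this⟩
    have hgoff := hax g hgj
    have hgx : (x g).x ≠ 0 := fun h0 => hgoff (by rw [h0]; ring)
    have hgy : (x g).y ≠ 0 := fun h0 => hgoff (by rw [h0]; ring)
    rcases lt_or_gt_of_ne hgj with hlt | hlt
    · obtain ⟨y, hy, heq, hg', hj', -⟩ := liftGeneric hdisj hfine hx hlt (hfree g)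
      have hyA : ∀ s : Fin 4, (y s).OnAlphabet h := fun s => hD y (mem_supp_of_memN D hy) s
      refine ⟨y, hy, fun f => ?_⟩
      by_cases hfg : f = g
      · subst hfg
        rcases hg' with he | hn
        · rw [← he]; exact hfree f
        · exact col_ne_zero_above_offAxis (hxA f) (hyA f) hn hgx hgy
      by_cases hfj : f = j
      · subst hfj
        rcases hj' with he | hn
        · rw [← he]; exact hfree f
        · exact col_ne_zero_above_offAxis (hxA f) (hyA f) hn hjx hjy
      · rw [← heq f hfg hfj]; exact hfree f
    · obtain ⟨y, hy, heq, hj', hg', -⟩ := liftGeneric hdisj hfine hx hlt (hfree j)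
      have hyA : ∀ s : Fin 4, (y s).OnAlphabet h := fun s => hD y (mem_supp_of_memN D hy) s
      refine ⟨y, hy, fun f => ?_⟩
      by_cases hfg : f = g
      · subst hfg
        rcases hg' with he | hn
        · rw [← he]; exact hfree f
        · exact col_ne_zero_above_offAxis (hxA f) (hyA f) hn hgx hgy
      by_cases hfj : f = j
      · subst hfj
        rcases hj' with he | hn
        · rw [← he]; exact hfree f
        · exact col_ne_zero_above_offAxis (hxA f) (hyA f) hn hjx hjy
      · rw [← heq f hfj hfg]; exact hfree f

/-- **BINDER COROLLARY, co-level words:** behind the fine door, if every supported N cell has a letter of co-level `0`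
(`ShellThreeClosed.NoHubfreeN`, the (M2)∕(M1)ₛ binder «hub-free N = ∅»), then every hub-free supported P cell is an axis cell. -/
theorem hubfreeP_axis_of_noHubfreeN (hD : D.OnAlphabet h) (hdisj : Disj D) (hfine : RuleDPFine D)
    (hN : ∀ y ∈ D.suppN, ∃ f : Fin 4, (y f).colevel = 0) :
    ∀ x ∈ D.suppP, (∀ f : Fin 4, (x f).colevel ≠ 0) → ∀ f : Fin 4, (x f).x * (x f).y = 0 := by
  intro x hx hfree f
  by_contra hoff
  have hjx : (x f).x ≠ 0 := fun h0 => hoff (by rw [h0]; ring)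
  have hjy : (x f).y ≠ 0 := fun h0 => hoff (by rw [h0]; ring)
  obtain ⟨y, hy, hyfree⟩ := hubfreeN_partner_of_offAxis hD hdisj hfine hx hfree hjx hjy
  obtain ⟨g, hg⟩ := hN y hy
  exact hyfree g hg

/-- **BINDER COROLLARY in `BoxCap`'s words: `NHubbed h D → HubfreePAxis h D`** behind the fine door — negation's displayed P-side binder
((B)+(Bu) of the shell-3 ledger, R19.718) follows from the N-side binder (M2) at EVERY shell and every height. -/
theorem hubfreePAxis_of_nHubbed (hD : D.OnAlphabet h) (hdisj : Disj D) (hfine : RuleDPFine D) (hN : NHubbed h D) :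
    HubfreePAxis h D := by
  intro c hc hfree f
  have hcA : ∀ s : Fin 4, (c s).OnAlphabet h := fun s => hD c (mem_supp_of_memP D hc) s
  have hfree' : ∀ s : Fin 4, (c s).colevel ≠ 0 := fun s h0 => hfree s (eq_hub_of_col_zero (hcA s) h0)
  have hN' : ∀ y ∈ D.suppN, ∃ f : Fin 4, (y f).colevel = 0 := fun y hy => by
    obtain ⟨g, hg⟩ := hN y hy
    exact ⟨g, col_zero_of_eq_hub hg⟩
  exact mul_eq_zero.mp (hubfreeP_axis_of_noHubfreeN hD hdisj hfine hN' c hc hfree' f)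

/-! ## §5 THE WEAK BINDER «every hub-free N cell is u⁴»: hub-free P = axis cells + hooks fed by two N u⁴ cells -/

/-- the annihilator of the line through the null step `lo → up`: `(β_up − β_lo, −(a_up − a_lo))`. -/
def annLine (lo up : Letter) : Fin 2 → GaussianInt := ![up.beta - lo.beta, intG (-(up.a - lo.a))]

theorem annLine_annihilates (lo up : Letter) : Annihilates (annLine lo up) lo up := by
  unfold Annihilates gPairing lineVec annLine intG
  simp only [Matrix.cons_val_zero, Matrix.cons_val_one]
  refine Zsqrtd.ext_iff.mpr ⟨?_, ?_⟩
  · simp [Zsqrtd.re_mul, Zsqrtd.re_add, Zsqrtd.re_sub]; ring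
  · simp [Zsqrtd.im_mul, Zsqrtd.im_add, Zsqrtd.im_sub]; ring

/-- a unit of the alphabet: exactly one of `x, y` is `±1`, the other `0`. -/
theorem unit_coords {u : Letter} (h1 : u.colevel = 1) :
    (u.x = 0 ∧ (u.y = 1 ∨ u.y = -1)) ∨ (u.y = 0 ∧ (u.x = 1 ∨ u.x = -1)) := by
  unfold Letter.colevel at h1
  rcases (abs_nonneg u.x).lt_or_eq with hlt | heq
  · have hy0 : |u.y| = 0 := by have := abs_nonneg u.y; omega
    have hx1 : |u.x| = 1 := by omega
    right
    refine ⟨abs_eq_zero.mp hy0, ?_⟩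
    rcases (abs_eq zero_le_one).mp hx1 with h | h
    · left; exact h
    · right; exact h
  · have hx0 : u.x = 0 := abs_eq_zero.mp heq.symm
    have hy1 : |u.y| = 1 := by omega
    left
    refine ⟨hx0, ?_⟩
    rcases (abs_eq zero_le_one).mp hy1 with h | h
    · left; exact h
    · right; exact h

/-- the bracket `W` of the unit-line functional has `Im W = x_X·y_{u′} − y_X·x_{u′} ≠ 0` for `X` off-axis and `u′` a unit. -/
theorem im_bracket_ne_zero {X u' : Letter} (hu'1 : u'.colevel = 1) (hjx : X.x ≠ 0) (hjy : X.y ≠ 0) (p q r : ℤ) :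
    star X.beta * (u'.beta - X.beta) + (⟨p, 0⟩ : GaussianInt) * ⟨q, 0⟩ + (⟨r, 0⟩ : GaussianInt) * ⟨q, 0⟩ ≠ 0 := by
  intro hW
  have him := congrArg Zsqrtd.im hW
  simp [Zsqrtd.im_mul, Zsqrtd.im_add, Zsqrtd.im_sub, Zsqrtd.star_mk, Letter.beta] at him
  rcases unit_coords hu'1 with ⟨hx0, hy | hy⟩ | ⟨hy0, hx' | hx'⟩
  · rw [hx0, hy] at him; apply hjx; nlinarith
  · rw [hx0, hy] at him; apply hjx; nlinarith
  · rw [hy0, hx'] at him; apply hjy; nlinarith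
  · rw [hy0, hx'] at him; apply hjy; nlinarith

/-- validity of (`annU u` on a unit slot `g`, `annLine X u′` on an OFF-AXIS slot `j`), `u′` a unit: the value is `−β_u · W` with
`Im W = x_X·y_{u′} − y_X·x_{u′} ≠ 0` (every height; no null-step hypothesis is even needed).  Orientation `g < j`, matrix `M₁`. -/
theorem fdetects_annU_annLine (c : Cell) (g j : Fin 4) {u' : Letter} (hg1 : (c g).colevel = 1) (hu'1 : u'.colevel = 1)
    (hjx : (c j).x ≠ 0) (hjy : (c j).y ≠ 0) :
    FDetects (annU (c g)) (annLine (c j) u') (blockM₁ c g j) := by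
  have hbg : (c g).beta ≠ 0 := beta_ne_zero_of_col_ne_zero (by rw [hg1]; norm_num)
  unfold FDetects blockM₁ annU annLine intG
  simp only [Matrix.of_apply, Matrix.cons_val', Matrix.cons_val_zero, Matrix.cons_val_one,
    Matrix.empty_val', Matrix.cons_val_fin_one, zero_mul, mul_zero, add_zero]
  intro h0
  have key : -(c g).beta * (star (c j).beta * (u'.beta - (c j).beta)
      + (⟨(c j).a - (c g).a, 0⟩ : GaussianInt) * ⟨-(u'.a - (c j).a), 0⟩ + (⟨-1, 0⟩ : GaussianInt) * ⟨-(u'.a - (c j).a), 0⟩) = 0 := by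
    linear_combination h0
  rcases mul_eq_zero.mp key with hb | hW
  · exact hbg (neg_eq_zero.mp hb)
  · exact im_bracket_ne_zero hu'1 hjx hjy _ _ _ hW

/-- the same functional, orientation `j < g` (off-axis slot first: `annLine` on the first slot, `annU` on the second), matrix `M₂`:
value `+β_u · W′` with the same imaginary part. -/
theorem fdetects_annLine_annU (c : Cell) (j g : Fin 4) {u' : Letter} (hg1 : (c g).colevel = 1) (hu'1 : u'.colevel = 1)
    (hjx : (c j).x ≠ 0) (hjy : (c j).y ≠ 0) :
    FDetects (annLine (c j) u') (annU (c g)) (blockM₂ c j g) := by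
  have hbg : (c g).beta ≠ 0 := beta_ne_zero_of_col_ne_zero (by rw [hg1]; norm_num)
  unfold FDetects blockM₂ annU annLine intG
  simp only [Matrix.of_apply, Matrix.cons_val', Matrix.cons_val_zero, Matrix.cons_val_one,
    Matrix.empty_val', Matrix.cons_val_fin_one, zero_mul, mul_zero, add_zero]
  intro h0
  have key : (c g).beta * (star (c j).beta * (u'.beta - (c j).beta)
      + (⟨-(u'.a - (c j).a), 0⟩ : GaussianInt) * ⟨(c g).a - (c j).a, 0⟩ * (-1) + (⟨-(u'.a - (c j).a), 0⟩ : GaussianInt) * ⟨-1, 0⟩) = 0 := by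
    linear_combination h0
  rcases mul_eq_zero.mp key with hb | hW
  · exact hbg hb
  · have e1 : (⟨-((c g).a - (c j).a), 0⟩ : GaussianInt) = -⟨(c g).a - (c j).a, 0⟩ := Zsqrtd.ext_iff.mpr ⟨by simp, by simp⟩
    refine im_bracket_ne_zero (X := c j) hu'1 hjx hjy (-((c g).a - (c j).a)) (-(u'.a - (c j).a)) (-1) ?_
    rw [e1]
    linear_combination hW

/-- **WEAK-BINDER THEOREM.** Behind the fine door, if every hub-free supported N cell has all co-levels `= 1` (is u⁴), then every
hub-free supported P cell `x` is EITHER an axis cell OR a hook fed twice: some slot `j` carries an OFF-AXIS letter, the three other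
slots are units, and there are two DISTINCT units `u′ ≠ u″` one null step above `x j` with both `x[j ↦ u′]`, `x[j ↦ u″]` supported
N cells (u⁴ cells).  (So `x j` has units above it on two different lines; on the alphabet: `|x| = |y| ∈ {1, 3}`, memo.) -/
theorem hubfreeP_axis_or_twofed_hook (hD : D.OnAlphabet h) (hdisj : Disj D) (hfine : RuleDPFine D)
    (hN : ∀ y ∈ D.suppN, (∀ f : Fin 4, (y f).colevel ≠ 0) → ∀ f : Fin 4, (y f).colevel = 1)
    {x : Cell} (hx : x ∈ D.suppP) (hfree : ∀ f : Fin 4, (x f).colevel ≠ 0) :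
    (∀ f : Fin 4, (x f).x * (x f).y = 0) ∨
    ∃ j : Fin 4, (x j).x ≠ 0 ∧ (x j).y ≠ 0 ∧ (∀ t : Fin 4, t ≠ j → (x t).colevel = 1) ∧
      ∃ y' ∈ D.suppN, ∃ y'' ∈ D.suppN, (∀ t : Fin 4, t ≠ j → y' t = x t) ∧ (∀ t : Fin 4, t ≠ j → y'' t = x t) ∧
        NullStep (x j) (y' j) ∧ NullStep (x j) (y'' j) ∧ (y' j).colevel = 1 ∧ (y'' j).colevel = 1 ∧ y' j ≠ y'' j := by
  have hxA : ∀ s : Fin 4, (x s).OnAlphabet h := fun s => hD x (mem_supp_of_memP D hx) s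
  by_cases hall : ∀ f : Fin 4, (x f).x * (x f).y = 0
  · exact Or.inl hall
  right
  push Not at hall
  obtain ⟨j, hoff⟩ := hall
  have hjx : (x j).x ≠ 0 := fun h0 => hoff (by rw [h0]; ring)
  have hjy : (x j).y ≠ 0 := fun h0 => hoff (by rw [h0]; ring)
  -- Step 1: some other slot is axis (else the generic row yields a hub-free N cell with an off-axis letter, not u⁴)
  have hax : ∃ g : Fin 4, g ≠ j ∧ (x g).x * (x g).y = 0 := by
    by_contra hno
    push Not at hno
    obtain ⟨g, hgj⟩ : ∃ g : Fin 4, g ≠ j := ⟨j + 1, by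
      intro hq; have := congrArg (fun t : Fin 4 => t - j) hq; simp at this⟩
    have hgoff := hno g hgj
    have hgx : (x g).x ≠ 0 := fun h0 => hgoff (by rw [h0]; ring)
    have hgy : (x g).y ≠ 0 := fun h0 => hgoff (by rw [h0]; ring)
    -- a third slot `k ∉ {g, j}` is off-axis as well and is kept by every server of the generic row
    obtain ⟨k, hkg, hkj⟩ : ∃ k : Fin 4, k ≠ g ∧ k ≠ j := by
      by_contra hn; push Not at hn
      have h0 := hn 0; have h1 := hn 1; have h2 := hn 2
      omega
    have hkoff := hno k hkj
    have hkx : (x k).x ≠ 0 := fun h0 => hkoff (by rw [h0]; ring)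
    have hky : (x k).y ≠ 0 := fun h0 => hkoff (by rw [h0]; ring)
    have hk2 := two_le_col_of_offAxis hkx hky
    rcases lt_or_gt_of_ne hgj with hlt | hlt
    · obtain ⟨y, hy, heq, hg', hj', -⟩ := liftGeneric hdisj hfine hx hlt (hfree g)
      have hyA : ∀ s : Fin 4, (y s).OnAlphabet h := fun s => hD y (mem_supp_of_memN D hy) s
      have hyfree : ∀ f : Fin 4, (y f).colevel ≠ 0 := by
        intro f
        by_cases hfg : f = g
        · subst hfg; rcases hg' with he | hn
          · rw [← he]; exact hfree f
          · exact col_ne_zero_above_offAxis (hxA f) (hyA f) hn hgx hgy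
        by_cases hfj : f = j
        · subst hfj; rcases hj' with he | hn
          · rw [← he]; exact hfree f
          · exact col_ne_zero_above_offAxis (hxA f) (hyA f) hn hjx hjy
        · rw [← heq f hfg hfj]; exact hfree f
      have := hN y hy hyfree k
      rw [← heq k hkg hkj] at this
      omega
    · obtain ⟨y, hy, heq, hj', hg', -⟩ := liftGeneric hdisj hfine hx hlt (hfree j)
      have hyA : ∀ s : Fin 4, (y s).OnAlphabet h := fun s => hD y (mem_supp_of_memN D hy) s
      have hyfree : ∀ f : Fin 4, (y f).colevel ≠ 0 := by
        intro f
        by_cases hfg : f = g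
        · subst hfg; rcases hg' with he | hn
          · rw [← he]; exact hfree f
          · exact col_ne_zero_above_offAxis (hxA f) (hyA f) hn hgx hgy
        by_cases hfj : f = j
        · subst hfj; rcases hj' with he | hn
          · rw [← he]; exact hfree f
          · exact col_ne_zero_above_offAxis (hxA f) (hyA f) hn hjx hjy
        · rw [← heq f hfj hfg]; exact hfree f
      have := hN y hy hyfree k
      rw [← heq k hkj hkg] at this
      omega
  -- Step 2: the axis lift at (g, j) gives the first u⁴ server y′ = x[j ↦ u′]; all other slots of x are units
  obtain ⟨g, hgj, hgax⟩ := hax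
  obtain ⟨y', hy', heq', hn'⟩ := liftAx hD hdisj hfine hx hgj hgax (hfree g) (hfree j)
  have hy'A : ∀ s : Fin 4, (y' s).OnAlphabet h := fun s => hD y' (mem_supp_of_memN D hy') s
  have hy'free : ∀ f : Fin 4, (y' f).colevel ≠ 0 := by
    intro f
    by_cases hf : f = j
    · subst hf; exact col_ne_zero_above_offAxis (hxA f) (hy'A f) hn' hjx hjy
    · rw [← heq' f hf]; exact hfree f
  have hy'1 := hN y' hy' hy'free
  have hunits : ∀ t : Fin 4, t ≠ j → (x t).colevel = 1 := fun t ht => by rw [heq' t ht]; exact hy'1 t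
  refine ⟨j, hjx, hjy, hunits, ?_⟩
  -- Step 3: the row (annU on g, annLine (x j) (y′ j) on j) gives a second server through a DIFFERENT unit
  have hg1 : (x g).colevel = 1 := hunits g hgj
  have hu'1 : (y' j).colevel = 1 := hy'1 j
  have second : ∃ y'' ∈ D.suppN, (∀ t : Fin 4, t ≠ j → x t = y'' t) ∧ NullStep (x j) (y'' j) ∧
      ¬ Annihilates (annLine (x j) (y' j)) (x j) (y'' j) := by
    rcases lt_or_gt_of_ne hgj with hlt | hlt
    · have hval : DMassValid x g j (annU (x g)) (annLine (x j) (y' j)) :=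
        ⟨hlt, Or.inl (fdetects_annU_annLine x g j hg1 hu'1 hjx hjy)⟩
      obtain ⟨y, hy, hc⟩ := hfine x hx g j _ _ hval
      have hyA : ∀ s : Fin 4, (y s).OnAlphabet h := fun s => hD y (mem_supp_of_memN D hy) s
      rcases hc with heq | ⟨hleg, hna⟩ | ⟨hleg, hnb⟩ | ⟨hr, hna, -⟩
      · exact (hdisj y hy (heq ▸ hx)).elim
      · exact (hna (annU_annihilates_gen (hxA g) (hyA g) hg1 hleg.1)).elim
      · exact ⟨y, hy, hleg.2, hleg.1, hnb⟩
      · exact (hna (annU_annihilates_gen (hxA g) (hyA g) hg1 hr.2.1)).elim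
    · have hval : DMassValid x j g (annLine (x j) (y' j)) (annU (x g)) :=
        ⟨hlt, Or.inr (fdetects_annLine_annU x j g hg1 hu'1 hjx hjy)⟩
      obtain ⟨y, hy, hc⟩ := hfine x hx j g _ _ hval
      have hyA : ∀ s : Fin 4, (y s).OnAlphabet h := fun s => hD y (mem_supp_of_memN D hy) s
      rcases hc with heq | ⟨hleg, hnb⟩ | ⟨hleg, hna⟩ | ⟨hr, -, hna⟩
      · exact (hdisj y hy (heq ▸ hx)).elim
      · exact ⟨y, hy, hleg.2, hleg.1, hnb⟩
      · exact (hna (annU_annihilates_gen (hxA g) (hyA g) hg1 hleg.1)).elim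
      · exact (hna (annU_annihilates_gen (hxA g) (hyA g) hg1 hr.2.2.1)).elim
  obtain ⟨y'', hy'', heq'', hn'', hnann⟩ := second
  have hy''A : ∀ s : Fin 4, (y'' s).OnAlphabet h := fun s => hD y'' (mem_supp_of_memN D hy'') s
  have hy''free : ∀ f : Fin 4, (y'' f).colevel ≠ 0 := by
    intro f
    by_cases hf : f = j
    · subst hf; exact col_ne_zero_above_offAxis (hxA f) (hy''A f) hn'' hjx hjy
    · rw [← heq'' f hf]; exact hfree f
  have hu''1 : (y'' j).colevel = 1 := hN y'' hy'' hy''free j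
  have hne : y' j ≠ y'' j := fun he => hnann (he ▸ annLine_annihilates (x j) (y' j))
  exact ⟨y', hy', y'', hy'', fun t ht => (heq' t ht).symm, fun t ht => (heq'' t ht).symm, hn', hn'', hu'1, hu''1, hne⟩


/-! ## §6 The alphabet classification: an off-axis letter with two distinct units one null step above it has `|x| = |y| ∈ {1, 3}` -/

/-- a unit `u` one null step above `X` on the alphabet: `|x| + |y| − |x|·|y| = x_u·x + y_u·y` (`= ±x` or `±y`). -/
theorem unit_above_eq {X u : Letter} (hX : X.OnAlphabet h) (hu : u.OnAlphabet h) (hu1 : u.colevel = 1) (hn : NullStep X u) :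
    |X.x| + |X.y| - |X.x| * |X.y| = u.x * X.x + u.y * X.y := by
  have ha := level_eq hX; have hua := level_eq hu
  rw [hu1] at hua
  unfold Letter.colevel at ha
  obtain ⟨-, hsq⟩ := hn
  rw [hua, ha] at hsq
  have hxx := sq_abs X.x; have hyy := sq_abs X.y
  rcases unit_coords hu1 with ⟨hx0, hy' | hy'⟩ | ⟨hy0, hx' | hx'⟩
  · rw [hx0, hy'] at hsq ⊢; nlinarith
  · rw [hx0, hy'] at hsq ⊢; nlinarith
  · rw [hy0, hx'] at hsq ⊢; nlinarith
  · rw [hy0, hx'] at hsq ⊢; nlinarith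

/-- the arithmetic core of case (iii): `P = s·x = t·y` with `s, t = ±1`, `x, y ≠ 0`, `P = |x| + |y| − |x|·|y|` forces `|x| = |y| ∈ {1, 3}`. -/
theorem abs_eq_one_or_three {x y s t : ℤ} (hx : x ≠ 0) (hs : s = 1 ∨ s = -1) (ht : t = 1 ∨ t = -1)
    (h1 : |x| + |y| - |x| * |y| = s * x) (h2 : |x| + |y| - |x| * |y| = t * y) : |x| = |y| ∧ (|x| = 1 ∨ |x| = 3) := by
  have e1 : |s * x| = |x| := by rcases hs with rfl | rfl <;> simp
  have e2 : |t * y| = |y| := by rcases ht with rfl | rfl <;> simp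
  have hm : |x| = |y| := by rw [← e1, ← h1, h2, e2]
  refine ⟨hm, ?_⟩
  have hP : |(|x| + |x| - |x| * |x|)| = |x| := by
    have h0 : |(|x| + |y| - |x| * |y|)| = |s * x| := by rw [h1]
    rw [e1, ← hm] at h0
    exact h0
  have hm0 : 0 < |x| := abs_pos.mpr hx
  rcases (abs_eq (abs_nonneg x)).mp hP with hc | hc
  · left
    have : |x| * (|x| - 1) = 0 := by nlinarith
    rcases mul_eq_zero.mp this with h0 | h0
    · exact absurd h0 (ne_of_gt hm0)
    · linarith
  · right
    have : |x| * (|x| - 3) = 0 := by nlinarith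
    rcases mul_eq_zero.mp this with h0 | h0
    · exact absurd h0 (ne_of_gt hm0)
    · linarith

/-- **ALPHABET CLASSIFICATION (every height).** An OFF-AXIS letter `X` of the alphabet with two DISTINCT units one null step above it has
`|x| = |y| = 1` (the letters `B`) or `|x| = |y| = 3` (co-level 6, via `3² + 4² = 5²`). -/
theorem two_units_above_offAxis {X u' u'' : Letter} (hX : X.OnAlphabet h) (hu' : u'.OnAlphabet h) (hu'' : u''.OnAlphabet h)
    (h1' : u'.colevel = 1) (h1'' : u''.colevel = 1) (hn' : NullStep X u') (hn'' : NullStep X u'') (hne : u' ≠ u'')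
    (hx : X.x ≠ 0) (hy : X.y ≠ 0) : |X.x| = |X.y| ∧ (|X.x| = 1 ∨ |X.x| = 3) := by
  have P1 := unit_above_eq hX hu' h1' hn'
  have P2 := unit_above_eq hX hu'' h1'' hn''
  have ha' := level_eq hu'; have ha'' := level_eq hu''
  rw [h1'] at ha'; rw [h1''] at ha''
  have hco : ¬ (u'.x = u''.x ∧ u'.y = u''.y) := by
    rintro ⟨ex, ey⟩
    apply hne
    cases u'; cases u''
    simp only [Letter.mk.injEq] at ex ey ha' ha'' ⊢
    exact ⟨by rw [ha', ha''], ex, ey⟩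
  have pm1 : (1 : ℤ) = 1 ∨ (1 : ℤ) = -1 := Or.inl rfl
  have pm2 : (-1 : ℤ) = 1 ∨ (-1 : ℤ) = -1 := Or.inr rfl
  rcases unit_coords h1' with ⟨hx0', hy' | hy'⟩ | ⟨hy0', hx' | hx'⟩ <;>
    rcases unit_coords h1'' with ⟨hx0'', hy'' | hy''⟩ | ⟨hy0'', hx'' | hx''⟩
  · rw [hx0', hy'] at P1
    rw [hx0'', hy''] at P2
    exact (hco ⟨by rw [hx0', hx0''], by rw [hy', hy'']⟩).elim
  · rw [hx0', hy'] at P1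
    rw [hx0'', hy''] at P2
    exact absurd (by linarith : X.y = 0) hy
  · rw [hx0', hy'] at P1
    rw [hy0'', hx''] at P2
    exact abs_eq_one_or_three hx pm1 pm1 (by linarith [P2] : |X.x| + |X.y| - |X.x| * |X.y| = 1 * X.x) (by linarith [P1] : |X.x| + |X.y| - |X.x| * |X.y| = 1 * X.y)
  · rw [hx0', hy'] at P1
    rw [hy0'', hx''] at P2
    exact abs_eq_one_or_three hx pm2 pm1 (by linarith [P2] : |X.x| + |X.y| - |X.x| * |X.y| = -1 * X.x) (by linarith [P1] : |X.x| + |X.y| - |X.x| * |X.y| = 1 * X.y)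
  · rw [hx0', hy'] at P1
    rw [hx0'', hy''] at P2
    exact absurd (by linarith : X.y = 0) hy
  · rw [hx0', hy'] at P1
    rw [hx0'', hy''] at P2
    exact (hco ⟨by rw [hx0', hx0''], by rw [hy', hy'']⟩).elim
  · rw [hx0', hy'] at P1
    rw [hy0'', hx''] at P2
    exact abs_eq_one_or_three hx pm1 pm2 (by linarith [P2] : |X.x| + |X.y| - |X.x| * |X.y| = 1 * X.x) (by linarith [P1] : |X.x| + |X.y| - |X.x| * |X.y| = -1 * X.y)
  · rw [hx0', hy'] at P1
    rw [hy0'', hx''] at P2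
    exact abs_eq_one_or_three hx pm2 pm2 (by linarith [P2] : |X.x| + |X.y| - |X.x| * |X.y| = -1 * X.x) (by linarith [P1] : |X.x| + |X.y| - |X.x| * |X.y| = -1 * X.y)
  · rw [hy0', hx'] at P1
    rw [hx0'', hy''] at P2
    exact abs_eq_one_or_three hx pm1 pm1 (by linarith [P1] : |X.x| + |X.y| - |X.x| * |X.y| = 1 * X.x) (by linarith [P2] : |X.x| + |X.y| - |X.x| * |X.y| = 1 * X.y)
  · rw [hy0', hx'] at P1
    rw [hx0'', hy''] at P2
    exact abs_eq_one_or_three hx pm1 pm2 (by linarith [P1] : |X.x| + |X.y| - |X.x| * |X.y| = 1 * X.x) (by linarith [P2] : |X.x| + |X.y| - |X.x| * |X.y| = -1 * X.y)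
  · rw [hy0', hx'] at P1
    rw [hy0'', hx''] at P2
    exact (hco ⟨by rw [hx', hx''], by rw [hy0', hy0'']⟩).elim
  · rw [hy0', hx'] at P1
    rw [hy0'', hx''] at P2
    exact absurd (by linarith : X.x = 0) hx
  · rw [hy0', hx'] at P1
    rw [hx0'', hy''] at P2
    exact abs_eq_one_or_three hx pm2 pm1 (by linarith [P1] : |X.x| + |X.y| - |X.x| * |X.y| = -1 * X.x) (by linarith [P2] : |X.x| + |X.y| - |X.x| * |X.y| = 1 * X.y)
  · rw [hy0', hx'] at P1
    rw [hx0'', hy''] at P2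
    exact abs_eq_one_or_three hx pm2 pm2 (by linarith [P1] : |X.x| + |X.y| - |X.x| * |X.y| = -1 * X.x) (by linarith [P2] : |X.x| + |X.y| - |X.x| * |X.y| = -1 * X.y)
  · rw [hy0', hx'] at P1
    rw [hy0'', hx''] at P2
    exact absurd (by linarith : X.x = 0) hx
  · rw [hy0', hx'] at P1
    rw [hy0'', hx''] at P2
    exact (hco ⟨by rw [hx', hx''], by rw [hy0', hy0'']⟩).elim

/-- **WEAK-BINDER COROLLARY with the classification:** behind the fine door, under «every hub-free supported N cell is u⁴», a hub-free
supported P cell is an axis cell, or a hook `(X; u, u, u)` whose off-axis letter has `|x| = |y| ∈ {1, 3}` — the B-hooks `u³B` and, from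
height 6 on, the co-level-6 hooks `u³X₍₃,₃₎` — fed by two supported N u⁴ cells. -/
theorem hubfreeP_axis_or_B_or_X33_hook (hD : D.OnAlphabet h) (hdisj : Disj D) (hfine : RuleDPFine D)
    (hN : ∀ y ∈ D.suppN, (∀ f : Fin 4, (y f).colevel ≠ 0) → ∀ f : Fin 4, (y f).colevel = 1)
    {x : Cell} (hx : x ∈ D.suppP) (hfree : ∀ f : Fin 4, (x f).colevel ≠ 0) :
    (∀ f : Fin 4, (x f).x * (x f).y = 0) ∨
    ∃ j : Fin 4, |(x j).x| = |(x j).y| ∧ (|(x j).x| = 1 ∨ |(x j).x| = 3) ∧ (∀ t : Fin 4, t ≠ j → (x t).colevel = 1) ∧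
      ∃ y' ∈ D.suppN, ∃ y'' ∈ D.suppN, (∀ t : Fin 4, t ≠ j → y' t = x t) ∧ (∀ t : Fin 4, t ≠ j → y'' t = x t) ∧
        (y' j).colevel = 1 ∧ (y'' j).colevel = 1 ∧ y' j ≠ y'' j := by
  rcases hubfreeP_axis_or_twofed_hook hD hdisj hfine hN hx hfree with hax | ⟨j, hjx, hjy, hunits, y', hy', y'', hy'', he', he'', hn', hn'', h1', h1'', hne⟩
  · exact Or.inl hax
  · right
    have hxA : (x j).OnAlphabet h := hD x (mem_supp_of_memP D hx) j
    have hy'A : (y' j).OnAlphabet h := hD y' (mem_supp_of_memN D hy') j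
    have hy''A : (y'' j).OnAlphabet h := hD y'' (mem_supp_of_memN D hy'') j
    obtain ⟨habs, h13⟩ := two_units_above_offAxis hxA hy'A hy''A h1' h1'' hn' hn'' hne hjx hjy
    exact ⟨j, habs, h13, hunits, y', hy', y'', hy'', he', he'', h1', h1'', hne⟩


/-! ## §7 (v1.1) The binder (Bu) of the shell-3 plate, in its own name, from (M2) behind the fine door (every shell, every height) -/

/-- **(Bu) from (M2) behind the fine door:** `NHubbed h D → ShellThreeFloorB.NoOffHubfreeP D` — no hub-free supported P cell has an off-axis letter.
With this, `ShellThreeClosed.shell3_empty_of_binders (B) (Bu) (M2)` needs the two displayed binders (B), (M2) and the fine door `RuleDPFine`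
(composition leaf `FineAxisLiftShell3.lean`, pending the farm build of `ShellThreeClosed`). -/
theorem noOffHubfreeP_of_nHubbed (hD : D.OnAlphabet h) (hdisj : Disj D) (hfine : RuleDPFine D) (hN : NHubbed h D) :
    NoOffHubfreeP D := by
  intro x hx hfree f hoff
  have hN' : ∀ y ∈ D.suppN, ∃ g : Fin 4, (y g).colevel = 0 := fun y hy => by
    obtain ⟨g, hg⟩ := hN y hy
    exact ⟨g, col_zero_of_eq_hub hg⟩
  exact (mul_ne_zero hoff.1 hoff.2) (hubfreeP_axis_of_noHubfreeN hD hdisj hfine hN' x hx hfree f)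

/-- the same with (M2) in co-level words (`ShellThreeClosed.NoHubfreeN`'s body). -/
theorem noOffHubfreeP_of_noHubfreeN (hD : D.OnAlphabet h) (hdisj : Disj D) (hfine : RuleDPFine D)
    (hN : ∀ y ∈ D.suppN, ∃ f : Fin 4, (y f).colevel = 0) : NoOffHubfreeP D :=
  fun x hx hfree f hoff => (mul_ne_zero hoff.1 hoff.2) (hubfreeP_axis_of_noHubfreeN hD hdisj hfine hN x hx hfree f)


/-! ## §8 (v1.2) The AXIS-N binder «every hub-free supported N cell is an axis cell»: hub-free P has at most ONE off-axis letter, lifted to an axis letter -/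

/-- **under «hub-free N all-axis», a hub-free supported P cell has AT MOST ONE off-axis slot** (every shell, every height). -/
theorem offAxis_unique_of_hubfreeN_axis (hD : D.OnAlphabet h) (hdisj : Disj D) (hfine : RuleDPFine D)
    (hN : ∀ y ∈ D.suppN, (∀ f : Fin 4, (y f).colevel ≠ 0) → ∀ f : Fin 4, (y f).x * (y f).y = 0)
    {x : Cell} (hx : x ∈ D.suppP) (hfree : ∀ f : Fin 4, (x f).colevel ≠ 0)
    {j j' : Fin 4} (hjj : j ≠ j') (hjx : (x j).x ≠ 0) (hjy : (x j).y ≠ 0) (hj'x : (x j').x ≠ 0) (hj'y : (x j').y ≠ 0) : False := by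
  have hxA : ∀ s : Fin 4, (x s).OnAlphabet h := fun s => hD x (mem_supp_of_memP D hx) s
  by_cases hax : ∃ g : Fin 4, g ≠ j ∧ (x g).x * (x g).y = 0
  · obtain ⟨g, hgj, hgax⟩ := hax
    obtain ⟨y, hy, heq, hn⟩ := liftAx hD hdisj hfine hx hgj hgax (hfree g) (hfree j)
    have hyA : ∀ s : Fin 4, (y s).OnAlphabet h := fun s => hD y (mem_supp_of_memN D hy) s
    have hyfree : ∀ f : Fin 4, (y f).colevel ≠ 0 := by
      intro f
      by_cases hf : f = j
      · subst hf; exact col_ne_zero_above_offAxis (hxA f) (hyA f) hn hjx hjy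
      · rw [← heq f hf]; exact hfree f
    have h0 := hN y hy hyfree j'
    rw [← heq j' hjj.symm] at h0
    exact (mul_ne_zero hj'x hj'y) h0
  · push Not at hax
    -- every slot other than `j` is off-axis; the generic server at the block {j, j'} keeps a third off-axis letter
    obtain ⟨k, hkj, hkj'⟩ : ∃ k : Fin 4, k ≠ j ∧ k ≠ j' := by
      by_contra hn; push Not at hn
      have h0 := hn 0; have h1 := hn 1; have h2 := hn 2
      omega
    have hkoff := hax k hkj
    have hkx : (x k).x ≠ 0 := fun h0 => hkoff (by rw [h0]; ring)
    have hky : (x k).y ≠ 0 := fun h0 => hkoff (by rw [h0]; ring)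
    rcases lt_or_gt_of_ne hjj with hlt | hlt
    · obtain ⟨y, hy, heq, hg', hj', -⟩ := liftGeneric hdisj hfine hx hlt (hfree j)
      have hyA : ∀ s : Fin 4, (y s).OnAlphabet h := fun s => hD y (mem_supp_of_memN D hy) s
      have hyfree : ∀ f : Fin 4, (y f).colevel ≠ 0 := by
        intro f
        by_cases hfg : f = j
        · subst hfg; rcases hg' with he | hn
          · rw [← he]; exact hfree f
          · exact col_ne_zero_above_offAxis (hxA f) (hyA f) hn hjx hjy
        by_cases hfj : f = j'
        · subst hfj; rcases hj' with he | hn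
          · rw [← he]; exact hfree f
          · exact col_ne_zero_above_offAxis (hxA f) (hyA f) hn hj'x hj'y
        · rw [← heq f hfg hfj]; exact hfree f
      have h0 := hN y hy hyfree k
      rw [← heq k hkj hkj'] at h0
      exact (mul_ne_zero hkx hky) h0
    · obtain ⟨y, hy, heq, hg', hj', -⟩ := liftGeneric hdisj hfine hx hlt (hfree j')
      have hyA : ∀ s : Fin 4, (y s).OnAlphabet h := fun s => hD y (mem_supp_of_memN D hy) s
      have hyfree : ∀ f : Fin 4, (y f).colevel ≠ 0 := by
        intro f
        by_cases hfg : f = j'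
        · subst hfg; rcases hg' with he | hn
          · rw [← he]; exact hfree f
          · exact col_ne_zero_above_offAxis (hxA f) (hyA f) hn hj'x hj'y
        by_cases hfj : f = j
        · subst hfj; rcases hj' with he | hn
          · rw [← he]; exact hfree f
          · exact col_ne_zero_above_offAxis (hxA f) (hyA f) hn hjx hjy
        · rw [← heq f hfg hfj]; exact hfree f
      have h0 := hN y hy hyfree k
      rw [← heq k hkj' hkj] at h0
      exact (mul_ne_zero hkx hky) h0

/-- **… and its off-axis letter lifts to an AXIS letter of a supported hub-free N cell** (the other three slots of `x` are axis, kept in `y`). -/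
theorem offAxis_lifts_to_axisN (hD : D.OnAlphabet h) (hdisj : Disj D) (hfine : RuleDPFine D)
    (hN : ∀ y ∈ D.suppN, (∀ f : Fin 4, (y f).colevel ≠ 0) → ∀ f : Fin 4, (y f).x * (y f).y = 0)
    {x : Cell} (hx : x ∈ D.suppP) (hfree : ∀ f : Fin 4, (x f).colevel ≠ 0)
    {j : Fin 4} (hjx : (x j).x ≠ 0) (hjy : (x j).y ≠ 0) :
    (∀ t : Fin 4, t ≠ j → (x t).x * (x t).y = 0) ∧
    ∃ y ∈ D.suppN, (∀ t : Fin 4, t ≠ j → x t = y t) ∧ NullStep (x j) (y j) ∧ (y j).x * (y j).y = 0 ∧ (y j).colevel ≠ 0 := by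
  have hxA : ∀ s : Fin 4, (x s).OnAlphabet h := fun s => hD x (mem_supp_of_memP D hx) s
  have hothers : ∀ t : Fin 4, t ≠ j → (x t).x * (x t).y = 0 := by
    intro t ht
    by_contra hoff
    have htx : (x t).x ≠ 0 := fun h0 => hoff (by rw [h0]; ring)
    have hty : (x t).y ≠ 0 := fun h0 => hoff (by rw [h0]; ring)
    exact offAxis_unique_of_hubfreeN_axis hD hdisj hfine hN hx hfree (Ne.symm ht) hjx hjy htx hty
  refine ⟨hothers, ?_⟩
  obtain ⟨g, hgj⟩ : ∃ g : Fin 4, g ≠ j := ⟨j + 1, by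
    intro hq; have := congrArg (fun t : Fin 4 => t - j) hq; simp at this⟩
  obtain ⟨y, hy, heq, hn⟩ := liftAx hD hdisj hfine hx hgj (hothers g hgj) (hfree g) (hfree j)
  have hyA : ∀ s : Fin 4, (y s).OnAlphabet h := fun s => hD y (mem_supp_of_memN D hy) s
  have hyfree : ∀ f : Fin 4, (y f).colevel ≠ 0 := by
    intro f
    by_cases hf : f = j
    · subst hf; exact col_ne_zero_above_offAxis (hxA f) (hyA f) hn hjx hjy
    · rw [← heq f hf]; exact hfree f
  exact ⟨y, hy, heq, hn, hN y hy hyfree j, hyfree j⟩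

end

end Summit.HodgeConjecture.HodgeConjecture.Cruxes.BlochSeedDiscOne.FineAxisLift
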